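import Summits.CriticalPhenomena.CardyFormulaZ2.Theorems.CardyBoundaryCoulombGasRectilinearCardyClosureDefs
import Summits.CriticalPhenomena.CardyFormulaZ2.Theorems.RectilinearCardy.Negative.RectilinearCardyReductions
import HarnessLib

/-!
# Stub stub_reverseInsert of line excursion-kernel-covariance (crux RectilinearCardy, stmt-CriticalPhenomena-5660): the reversed mark-inserted conformal rectangle exists

For a conformal rectangle `R = (Ω; a, b, c, d)` (marks `mark 0 < mark 1 < mark 2 < mark 3` in
`Ico 0 1`) and an extra boundary parameter `τ ∈ (mark 1, mark 3)` (the inserted point `x = ∂Ω(τ)`),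
there is a marked domain `D : MarkedDomain 4` with the SAME carrier `Ω`, the boundary loop run
backwards, `D.boundary t = R.boundary (mark 0 + mark 3 - t)`, and marks
`(mark 0, mark 0 + mark 3 - τ, mark 0 + mark 3 - mark 1, mark 3)`, i.e. marked points
`(d, x, b, a)` met in increasing parameter order. This is the re-parametrisation the lead's
composition feeds to the route's engine `BoundaryDefectGaussianR` (marks counter-clockwise, sink at
index 1) for a clockwise `R`.

Proof: the `JordanDomain` fields of `D` are those of `R` transported along the affine involution
`t ↦ mark 0 + mark 3 - t` of the parameter line: continuity by composition, `1`-periodicity from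
`R.periodic_boundary` (`∂Ω(c - (t + 1)) = ∂Ω((c - t) - 1)`), the range is unchanged because the
involution is surjective, and injectivity on the period `Ico 0 1` because two parameters with the
same boundary point differ by an integer (`rvi_exists_int_of_boundary_eq`: reduce to fractional
parts, `Function.Periodic.sub_int_mul_eq`, `Int.fract_eq_fract`, `R.injOn_boundary`) and
`|s - t| < 1` on `Ico 0 1`. The marks are strictly increasing by `mark 0 < mark 1 < τ < mark 3` and
lie in `[mark 0, mark 3] ⊆ Ico 0 1`. Adapted from the def-free orientation reversal of a Dobrushin
domain, `Theorems/LagHandOff/Negative/ArcSwap.lean` (`exists_orientationReversed`). Folklore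
(Werner, *Lectures on two-dimensional critical percolation* (2007), §2: the orientation of the
boundary loop of a Jordan domain is immaterial).
-/

noncomputable section

open Set Filter Topology MeasureTheory Metric
open Literature.Probability.RandomPlanarGeometry

namespace Summit.CriticalPhenomena.CardyFormulaZ2.Cruxes.RectilinearCardy.ExcursionKernelCovariance

/-- Equal boundary points of a Jordan domain have parameters differing by an integer: the loop only
sees the fractional part of the parameter (`1`-periodicity) and is injective on the period `Ico 0 1`.
[folklore] -/
-- adapted from Summits/CriticalPhenomena/CardyFormulaZ2/Theorems/LagHandOff/Negative/ArcSwap.lean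
-- (`exists_int_of_boundary_eq`)
private theorem rvi_exists_int_of_boundary_eq (D : JordanDomain) {s t : ℝ}
    (h : D.boundary s = D.boundary t) : ∃ z : ℤ, s - t = z := by
  have hf : ∀ u : ℝ, D.boundary (Int.fract u) = D.boundary u := fun u => by
    rw [← Int.self_sub_floor]
    simpa using D.periodic_boundary.sub_int_mul_eq ⌊u⌋ (x := u)
  rw [← hf s, ← hf t] at h
  have hs : Int.fract s ∈ Ico (0 : ℝ) 1 := ⟨Int.fract_nonneg s, Int.fract_lt_one s⟩
  have ht : Int.fract t ∈ Ico (0 : ℝ) 1 := ⟨Int.fract_nonneg t, Int.fract_lt_one t⟩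
  exact Int.fract_eq_fract.1 (D.injOn_boundary hs ht h)

/-- A `1`-periodic simple loop run backwards from any base parameter `c`, `t ↦ ∂D (c - t)`, is again
injective on the period `Ico 0 1`. [folklore] -/
private theorem rvi_injOn_boundary_const_sub (D : JordanDomain) (c : ℝ) :
    InjOn (fun t : ℝ => D.boundary (c - t)) (Ico (0 : ℝ) 1) := by
  intro s hs t ht h
  obtain ⟨z, hz⟩ := rvi_exists_int_of_boundary_eq D h
  have h1 : (-1 : ℝ) < ((z : ℤ) : ℝ) := by linarith [hs.1, hs.2, ht.1, ht.2]
  have h2 : ((z : ℤ) : ℝ) < 1 := by linarith [hs.1, hs.2, ht.1, ht.2]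
  have hz1 : (-1 : ℤ) < z := by exact_mod_cast h1
  have hz2 : z < 1 := by exact_mod_cast h2
  have hz0 : z = 0 := by omega
  rw [hz0, Int.cast_zero] at hz
  linarith

/-- Running a loop backwards from a base parameter does not change its range (the affine involution
`t ↦ c - t` of the parameter line is surjective). [folklore] -/
private theorem rvi_range_boundary_const_sub (D : JordanDomain) (c : ℝ) :
    range (fun t : ℝ => D.boundary (c - t)) = frontier D.carrier := by
  have hsurj : Function.Surjective fun t : ℝ => c - t := fun y => ⟨c - y, sub_sub_cancel _ _⟩
  rw [show (fun t : ℝ => D.boundary (c - t)) = D.boundary ∘ fun t : ℝ => c - t from rfl,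
    hsurj.range_comp]
  exact D.range_boundary

/-- **Stub V `stub_reverseInsert` (the reversed mark-inserted marked domain exists)** (registered
signature, verbatim). For a conformal rectangle `R` and `τ ∈ (R.mark 1, R.mark 3)` there is a
marked domain `D : MarkedDomain 4` with the same carrier, the boundary loop run backwards,
`D.boundary t = R.boundary (R.mark 0 + R.mark 3 - t)`, and marks
`![R.mark 0, R.mark 0 + R.mark 3 - τ, R.mark 0 + R.mark 3 - R.mark 1, R.mark 3]` — the marked points
`(d, ∂Ω(τ), b, a)` of `R` met in increasing parameter order. [folklore] -/
theorem stub_reverseInsert :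
    ∀ (R : ConformalRectangle) (τ : ℝ), R.mark 1 < τ → τ < R.mark 3 →
      ∃ D : MarkedDomain 4, D.carrier = R.carrier ∧
        (∀ t : ℝ, D.boundary t = R.boundary (R.mark 0 + R.mark 3 - t)) ∧
        D.mark = ![R.mark 0, R.mark 0 + R.mark 3 - τ, R.mark 0 + R.mark 3 - R.mark 1, R.mark 3] := by
  intro R τ h1τ hτ3
  have h01 : R.mark 0 < R.mark 1 := R.strictMono_mark (show (0 : Fin 4) < 1 by decide)
  have h0 : R.mark 0 ∈ Ico (0 : ℝ) 1 := R.mark_mem 0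
  have h3 : R.mark 3 ∈ Ico (0 : ℝ) 1 := R.mark_mem 3
  -- adapted from `exists_orientationReversed` (Theorems/LagHandOff/Negative/ArcSwap.lean)
  refine ⟨{ carrier := R.carrier
            boundary := fun t => R.boundary (R.mark 0 + R.mark 3 - t)
            isOpen := R.isOpen
            isBounded := R.isBounded
            isConnected := R.isConnected
            continuous_boundary := R.continuous_boundary.comp (continuous_const.sub continuous_id)
            periodic_boundary := fun t => by
              show R.boundary (R.mark 0 + R.mark 3 - (t + 1)) = R.boundary (R.mark 0 + R.mark 3 - t)
              rw [show R.mark 0 + R.mark 3 - (t + 1) = (R.mark 0 + R.mark 3 - t) - 1 by ring]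
              exact R.periodic_boundary.sub_eq (R.mark 0 + R.mark 3 - t)
            injOn_boundary := rvi_injOn_boundary_const_sub R.toJordanDomain (R.mark 0 + R.mark 3)
            range_boundary := rvi_range_boundary_const_sub R.toJordanDomain (R.mark 0 + R.mark 3)
            mark := ![R.mark 0, R.mark 0 + R.mark 3 - τ, R.mark 0 + R.mark 3 - R.mark 1, R.mark 3]
            strictMono_mark := by
              refine Fin.strictMono_iff_lt_succ.2 fun k => ?_
              fin_cases k
              · show R.mark 0 < R.mark 0 + R.mark 3 - τ
                linarith
              · show R.mark 0 + R.mark 3 - τ < R.mark 0 + R.mark 3 - R.mark 1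
                linarith
              · show R.mark 0 + R.mark 3 - R.mark 1 < R.mark 3
                linarith
            mark_mem := by
              intro k
              fin_cases k
              · exact h0
              · show R.mark 0 + R.mark 3 - τ ∈ Ico (0 : ℝ) 1
                exact ⟨by linarith [h0.1], by linarith [h3.2]⟩
              · show R.mark 0 + R.mark 3 - R.mark 1 ∈ Ico (0 : ℝ) 1
                exact ⟨by linarith [h0.1, hτ3.le], by linarith [h3.2]⟩
              · exact h3 }, rfl, fun _ => rfl, rfl⟩

end Summit.CriticalPhenomena.CardyFormulaZ2.Cruxes.RectilinearCardy.ExcursionKernelCovariance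

end
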